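import Literature.NumberTheory.GaloisRepresentations.FrobeniusPlaces
import HarnessLib

/-!
# A Frobenius in `res(Γ_L)` forces a place of residue degree one

Decomposition-field dictionary for the Satake-level form of the base-change ascent operator of
the crux `IrreducibleOffSector` (stmt-Langlands-14329,
`Summit.Langlands.Langlands.Theses.IrreducibilityBySelfDuality.IrreducibleOffSector`, route
`Langlands/IrreducibilityBySelfDuality`, line `Sketch`, lead c7, stub W8).

For a cyclic extension `L/K` of prime degree `p`, the Satake-level ascent criterion says: if at
infinitely many places `v` of `K` that are *not* split in `L` the Satake multiset of `π` is not
invariant under multiplication by a primitive `p`-th root of unity, then an irreducible avatar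
`ρ₀` of `π` has no Galois self-twist by a character of `Gal(L/K)`, so irreducibility ascends to
`BC_{L/K}(π)`.  It is applied contrapositively through the present dictionary: an arithmetic
Frobenius `σ ∈ Γ_K` at a prime `𝔓 ∣ v` of `\bar ℤ_K` that lies in the image `res(Γ_L)` of the
restriction `absGaloisRestrict K L : Γ_L →ₜ* Γ_K` (equivalently, `χ σ = 1` for every character
`χ` of `Γ_K` trivial on `res(Γ_L)`) forces a place `w ∣ v` of `L` of residue degree
`f(w|v) = 1`; when `L/K` is Galois this says that `v` is split in `L`.

* `Summit.Langlands.Langlands.Theorems.IrreducibleOffSector.exists_place_inertiaDeg_eq_one_of_isArithFrobAt_mem_range`.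

Proof.  By `Literature.NumberTheory.GaloisRepresentations.exists_place_comap_eq_smul` (with
`g = 1`) the prime `𝔓` is `ι⁻¹ 𝔔` for a prime `𝔔` of `\bar ℤ_L` above a place `w ∣ v` of `L`
(`ι : \bar ℤ_K ≅ \bar ℤ_L` the isomorphism of absolute integers, `absIntegersMap`); writing
`σ = res τ`, `Literature.NumberTheory.GaloisRepresentations.inertiaDeg_eq_one_of_isArithFrobAt_absGaloisRestrict`
(Marcus, *Number Fields*, Ch. 4, Thm. 29: the decomposition field) gives `f(w|v) = 1`.

References: D. A. Marcus, *Number Fields* (2018), Ch. 4, Thm. 28–29; J. Neukirch, *Algebraic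
Number Theory* (1999), Ch. I §9, (9.3)–(9.5).
-/

noncomputable section

-- `Summit.Langlands.Langlands.…` (summit = sub-problem name, D-0017 layout) trips `dupNamespace`
set_option linter.dupNamespace false

open scoped NumberField
open IsDedekindDomain
open Literature.NumberTheory.GaloisRepresentations Field

namespace Summit.Langlands.Langlands.Theorems.IrreducibleOffSector

/-- **A Frobenius in `res(Γ_L)` forces a place of residue degree one** (the decomposition-field
dictionary).  Let `L/K` be an extension of number fields, `v` a finite place of `K`, `𝔓 ∣ v` a
prime of `\bar ℤ_K` and `σ ∈ Γ_K` an arithmetic Frobenius at `𝔓`.  If `σ` lies in the image of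
the restriction map `res : Γ_L → Γ_K`, then there is a place `w ∣ v` of `L` with `f(w|v) = 1`:
namely the place below the prime `ι 𝔓` of `\bar ℤ_L`, on whose residue field `σ = res τ` acts
both trivially on `𝓞 L / w` (as `τ` fixes `L`) and as `x ↦ x ^ {q_v}`.
Ref: Marcus, *Number Fields*, Ch. 4, Thm. 29; Neukirch, *Algebraic Number Theory*, Ch. I (9.3).
[folklore] -/
theorem exists_place_inertiaDeg_eq_one_of_isArithFrobAt_mem_range {K L : Type} [Field K]
    [NumberField K] [Field L] [NumberField L] [Algebra K L] {v : HeightOneSpectrum (𝓞 K)}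
    {𝔓 : Ideal (absIntegers (𝓞 K) K)} (h𝔓 : 𝔓 ∈ v.primesAbove) {σ : absoluteGaloisGroup K}
    (hσ : IsArithFrobAt (𝓞 K) σ 𝔓)
    (hmem : σ ∈ ((absGaloisRestrict K L).range : Subgroup (absoluteGaloisGroup K))) :
    ∃ w : HeightOneSpectrum (𝓞 L),
      w.asIdeal.under (𝓞 K) = v.asIdeal ∧ w.asIdeal.inertiaDeg (𝓞 K) = 1 := by
  -- `𝔓 = ι⁻¹ 𝔔` for a prime `𝔔` of `\bar ℤ_L` above a place `w ∣ v` of `L`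
  obtain ⟨𝔔, w, h𝔔𝔓, hw, h𝔔⟩ := exists_place_comap_eq_smul (F := K) (M := L) h𝔓 1
  rw [one_smul] at h𝔔𝔓
  -- `σ = res τ` with `τ ∈ Γ_L`
  obtain ⟨τ, rfl⟩ := hmem
  refine ⟨w, hw, inertiaDeg_eq_one_of_isArithFrobAt_absGaloisRestrict (τ := τ) hw h𝔔 ?_⟩
  rw [h𝔔𝔓]
  exact hσ

end Summit.Langlands.Langlands.Theorems.IrreducibleOffSector

end
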